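import Summits.RiemannHypothesis.RiemannHypothesis.Theses.WeilComb
import Summits.RiemannHypothesis.RiemannHypothesis.Theorems.WeilCombCombShapeDetection
import Summits.RiemannHypothesis.RiemannHypothesis.Theorems.WeilCombCombShapeAdmissible
import Summits.RiemannHypothesis.RiemannHypothesis.Theorems.WeilCombCombShapePositivityStubCauchyKernelJump
import Summits.RiemannHypothesis.RiemannHypothesis.Theorems.WeilCombCombShapePositivityStubDilationKernelSum
import Literature.NumberTheory.LFunctions.WeilCriterionConverse
import Literature.NumberTheory.LFunctions.WeilExplicitFormulaProofs
import Literature.NumberTheory.LFunctions.WeilExplicitProofs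
import Literature.NumberTheory.LFunctions.WeilMellinBounds
import Literature.NumberTheory.LFunctions.WeilMellinInversion
import Literature.NumberTheory.LFunctions.WeilDilationVirial
import Literature.NumberTheory.LFunctions.WeilZeroSum
import Literature.NumberTheory.LFunctions.LandauOscillation
import Mathlib

/-!
# Dilation detection III — Landau's lemma in the dilation variable; the one-zero kernel on a line

stub-plan `Cruxes/CombShapePositivity/STUB-PLAN-stub_fejer.md`, tier ★T2 DILATION DETECTION
(crux `WeilComb.CombShapePositivity`, item stmt-RiemannHypothesis-11229, route route-RiemannHypothesis-WeilComb,
line `Sketch`; sprove seat). The five files `…StubDilationSeries` → `…KernelSum` → `…Landau` → `…Geometry` →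
`…Detection` prove `stub_dilationDetection : (∀ ε ≥ 1, 0 ≤ Re W(φ_ε ⋆ φ̃_ε)) → RiemannHypothesis`
(a theorem ABOUT the RH-equivalent stub `stub_fejer` — its `S = ∅` face is already RH-complete — not a step
of `CombShapePositivity_of`).

This file: `integrableOn_gL` (Landau's hypothesis at `σ₁ = 2`), the cone `W₀ = {0 < Re s < 4, |Im s| < κ Re s}`
(open, convex), `differentiableOn_mellinIoi_gL` (registered as `laplaceDiag_differentiableOn`): if
`Re Q(φ_ε) ≥ 0` for `ε ≥ 1` and the cone misses every segment, then `F(s) = ∫_1^∞ g x^{−(s+1)} dx` is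
holomorphic on `Re s > 0` (`Landau.integrableOn_of_differentiableOn_union_convex`); `eqOn_mellinIoi_GK`:
`F = G_univ` on every open convex segment-free set meeting `Re s > 2` (identity theorem). Finally the symmetry
`K(−w) = K(w)` and the jump of ONE kernel on the line `ℝ·w₀` approached along the common normal
(`kernel_jump_on_line`, from `cauchyKernel_jump`), with the real/imaginary parts of the approach points.
-/

noncomputable section

-- the sub-problem path RiemannHypothesis/RiemannHypothesis duplicates a namespace (D-0017)
set_option linter.dupNamespace false

open scoped BigOperators ComplexConjugate Real Topology
open Complex MeasureTheory Set Filter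

namespace Summit.RiemannHypothesis.RiemannHypothesis.Theorems.WeilCombBohrFejer

open Literature.NumberTheory.LFunctions
open Literature.NumberTheory.LFunctions.WeilConverse

/-! ## Notation (local, purely syntactic abbreviations of sub-terms of the registered stubs) -/

/-- the route bump `φ_ε(t) = ε⁻¹ φ₀(t/ε)` (verbatim sub-term of the registered stubs). -/
local notation "φb(" ε ")" =>
  (fun t : ℝ => ((ε : ℝ) : ℂ)⁻¹ * ((expNegInvGlue (1 - (t / ε) ^ 2) : ℝ) : ℂ))

/-- the fixed bump as a complex function `φ₀ℂ(u) = expNegInvGlue (1 - u²)`. -/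
local notation "φ₀ℂ" => (fun u : ℝ => ((expNegInvGlue (1 - u ^ 2) : ℝ) : ℂ))

/-- its entire transform `Φ₀(z) = ∫ φ₀(u) e^{zu} du`. -/
local notation "Φ₀(" z ")" =>
  (∫ u : ℝ, ((expNegInvGlue (1 - u ^ 2) : ℝ) : ℂ) * Complex.exp (z * u))

/-- the autocorrelation `ψ₀ = φ₀ ⋆ φ₀`. -/
local notation "ψ₀(" t ")" =>
  (∫ u : ℝ, expNegInvGlue (1 - u ^ 2) * expNegInvGlue (1 - (t - u) ^ 2))

/-- the Cauchy–Laplace kernel of `ψ₀`: `K(w, s) = ∫_{-2}^{2} ψ₀(t) e^{wt − s}/(s − wt) dt`. -/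
local notation "Kψ(" w ", " s ")" =>
  (∫ t in (-2 : ℝ)..2, (((∫ u : ℝ, expNegInvGlue (1 - u ^ 2) * expNegInvGlue (1 - (t - u) ^ 2)) : ℝ) : ℂ) *
    Complex.exp (w * t - s) / (s - w * t))

/-- the set of non-trivial zeros (subtype). -/
local notation "𝒵" => ZetaZeros.riemannZetaNontrivialZeros

/-- `g(x) = Re Q(φ_{log x})` for `x > e`, `0` otherwise — the non-negative function of Landau's
lemma, in the multiplicative variable `x = e^ε`. Written with `max 1 (log x)` so that measurability
is immediate. -/
local notation "gL" =>
  (Set.indicator (Set.Ioi (Real.exp 1)) (fun x : ℝ => Complex.re (weilQuadratic φb(max 1 (Real.log x)))))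

/-- the kernel attached to a complex number `ρ'` (weighted by the multiplicity) restricted to a
set `P` of zeros. -/
local notation "KP(" P ", " ρ' ", " s ")" =>
  (Set.indicator P (fun ρ'' : ℂ => (riemannZetaZeroOrder ρ'' : ℂ) * Kψ(ρ'' - 1 / 2, s)) ρ')

/-- the zero sum of kernels over the zeros in `P`: `G_P(s) = Σ_{ρ ∈ P} m(ρ) K(ρ − ½, s)`. -/
local notation "GK(" P ", " s ")" => (∑' ρ : 𝒵, KP(P, (ρ : ℂ), s))

set_option quotPrecheck false in
/-- the natural domain of `G_P`: the right half-plane minus the segments `(ρ − ½)·[−2, 2]` of the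
zeros `ρ ∈ P` (segments of on-line zeros lie on the imaginary axis and are excluded for free). -/
local notation "UP(" P ")" =>
  (setOf fun s : ℂ => 0 < Complex.re s ∧ ∀ ρ' : ℂ, ρ' ∈ P → ρ' ∈ ZetaZeros.riemannZetaNontrivialZeros →
    ∀ t : ℝ, t ∈ Set.Icc (-2 : ℝ) 2 → s ≠ (ρ' - 1 / 2) * t)

/-! ## The function fed to Landau's lemma (re-proved here: measurability and the Laplace substitution) -/

/-- `gL` is measurable. [folklore] -/
theorem measurable_gL : Measurable gL := by
  have hm : Measurable fun x : ℝ => weilQuadratic φb(max 1 (Real.log x)) := by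
    have h1 : Continuous fun y : ℝ => max 1 y := continuous_const.max continuous_id
    have h2 : ∀ y : ℝ, max 1 y ∈ Ici (1 : ℝ) := fun y => Set.mem_Ici.2 (le_max_left _ _)
    have h3 : Continuous fun y : ℝ => weilQuadratic φb(max 1 y) :=
      continuousOn_weilQuadratic_bump.comp_continuous h1 h2
    exact h3.measurable.comp Real.measurable_log
  exact (Complex.measurable_re.comp hm).indicator measurableSet_Ioi

/-- For `x > e`, `max 1 (log x) = log x`. [folklore] -/
theorem max_one_log_of_exp_lt {x : ℝ} (hx : Real.exp 1 < x) : max 1 (Real.log x) = Real.log x :=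
  max_eq_right ((Real.lt_log_iff_exp_lt (lt_trans (Real.exp_pos 1) hx)).2 hx).le

/-- **The transform of Landau's lemma is the Laplace transform in the dilation variable**:
`∫_1^∞ g(x) x^{−(s+1)} dx = ∫_1^∞ Q(φ_ε) e^{−sε} dε` (substitute `x = e^ε`; `Q` is real).
[folklore] -/
theorem mellinIoi_gL (s : ℂ) :
    Landau.mellinIoi gL s = ∫ ε in Ioi (1 : ℝ), weilQuadratic φb(ε) * Complex.exp (-(s * ε)) := by
  unfold Landau.mellinIoi
  -- restrict to `(e, ∞)`, where `g` lives
  have hsub : Ioi (Real.exp 1) ⊆ Ioi (1 : ℝ) := Ioi_subset_Ioi (Real.one_lt_exp_iff.2 one_pos).le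
  rw [setIntegral_eq_of_subset_of_forall_sdiff_eq_zero measurableSet_Ioi hsub (fun x hx => by
    have hx' : x ∉ Ioi (Real.exp 1) := hx.2
    simp [Set.indicator_of_notMem hx'])]
  -- substitute `x = e^ε`
  rw [setIntegral_congr_set (show Ioi (Real.exp 1) =ᵐ[volume] Real.exp '' Ioi 1 by
      rw [Real.image_exp_Ioi]),
    integral_image_eq_integral_abs_deriv_smul measurableSet_Ioi
      (fun x _ => (Real.hasDerivAt_exp x).hasDerivWithinAt) Real.exp_injective.injOn]
  refine setIntegral_congr_fun measurableSet_Ioi fun ε hε => ?_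
  have hε : (1 : ℝ) < ε := hε
  have hx : Real.exp 1 < Real.exp ε := Real.exp_lt_exp.2 hε
  simp only [Set.indicator_of_mem (show Real.exp ε ∈ Ioi (Real.exp 1) from hx), Real.log_exp,
    max_eq_right hε.le, abs_of_pos (Real.exp_pos ε), Complex.real_smul]
  rw [← weilQuadratic_bump_eq_re ε]
  have hpow : ((Real.exp ε : ℝ) : ℂ) ^ (-(s + 1)) = Complex.exp (-(s + 1) * ε) := by
    rw [Complex.ofReal_exp, Complex.cpow_def_of_ne_zero (Complex.exp_ne_zero _),
      Complex.log_exp (by simp [Real.pi_pos]) (by simp [Real.pi_pos.le]), mul_comm]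
  rw [hpow, Complex.ofReal_exp]
  have : Complex.exp (ε : ℂ) * Complex.exp (-(s + 1) * ε) = Complex.exp (-(s * ε)) := by
    rw [← Complex.exp_add]; ring_nf
  calc Complex.exp (ε : ℂ) * (weilQuadratic φb(ε) * Complex.exp (-(s + 1) * ε))
      = weilQuadratic φb(ε) * (Complex.exp (ε : ℂ) * Complex.exp (-(s + 1) * ε)) := by ring
    _ = _ := by rw [this]

/-! ## B3 · Landau's lemma in the dilation variable -/

/-- Landau's integrability hypothesis at `σ₁ = 2`: `∫_1^∞ |g(x)| x^{-3} dx < ∞`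
(`|g(x)| ≤ C₁ x` for `x > e`). [folklore] -/
theorem integrableOn_gL : IntegrableOn (fun x : ℝ => gL x * x ^ (-((2 : ℝ) + 1))) (Ioi 1) := by
  obtain ⟨C₁, hC₁0, hC₁⟩ := norm_weilQuadratic_bump_le
  have hdom : IntegrableOn (fun x : ℝ => C₁ * x ^ (-2 : ℝ)) (Ioi 1) :=
    (integrableOn_Ioi_rpow_of_lt (by norm_num) one_pos).const_mul C₁
  refine Integrable.mono' hdom ?_ ?_
  · exact (measurable_gL.mul (measurable_id.pow_const _)).aestronglyMeasurable
  · refine (ae_restrict_iff' measurableSet_Ioi).2 (Eventually.of_forall fun x hx => ?_)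
    have hx0 : 0 < x := lt_trans one_pos hx
    have hx3 : 0 ≤ x ^ (-((2 : ℝ) + 1)) := Real.rpow_nonneg hx0.le _
    rw [norm_mul, Real.norm_eq_abs, Real.norm_eq_abs, abs_of_nonneg hx3]
    by_cases hxe : Real.exp 1 < x
    · have hg : |gL x| ≤ C₁ * x := by
        simp only [Set.indicator_of_mem (show x ∈ Ioi (Real.exp 1) from hxe),
          max_one_log_of_exp_lt hxe]
        refine (Complex.abs_re_le_norm _).trans ((hC₁ (Real.log x) ?_).trans (le_of_eq ?_))
        · exact ((Real.lt_log_iff_exp_lt hx0).2 hxe).le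
        · rw [Real.exp_log hx0]
      calc |gL x| * x ^ (-((2 : ℝ) + 1)) ≤ C₁ * x * x ^ (-((2 : ℝ) + 1)) :=
            mul_le_mul_of_nonneg_right hg hx3
        _ = C₁ * x ^ (-2 : ℝ) := by
            rw [show -((2 : ℝ) + 1) = (-2 : ℝ) + (-1) by norm_num, Real.rpow_add hx0,
              Real.rpow_neg_one, mul_assoc, mul_comm x, mul_assoc, inv_mul_cancel₀ hx0.ne', mul_one]
    · have hx' : x ∉ Ioi (Real.exp 1) := hxe
      simp only [Set.indicator_of_notMem hx', abs_zero, zero_mul]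
      positivity

/-- The real points `σ > 2` are off every segment: `{Re s > 2} ⊆ U_univ`. More generally any `s`
with `Re s > 1`. [folklore] -/
theorem mem_UP_of_one_lt_re {s : ℂ} (hs : 1 < s.re) : s ∈ UP(Set.univ) := by
  refine ⟨by linarith, fun ρ' _ hρ' t ht => ?_⟩
  rintro rfl
  have h1 : |(ρ' - 1 / 2).re| ≤ 1 / 2 := abs_re_sub_half_le hρ'
  have h2 : |t| ≤ 2 := abs_le.2 ⟨by linarith [ht.1], ht.2⟩
  have h3 : ((ρ' - 1 / 2) * (t : ℂ)).re = (ρ' - 1 / 2).re * t := by simp [Complex.mul_re]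
  rw [h3] at hs
  have : (ρ' - 1 / 2).re * t ≤ |(ρ' - 1 / 2).re| * |t| := by
    rw [← abs_mul]; exact le_abs_self _
  nlinarith [abs_nonneg t, abs_nonneg (ρ' - 1 / 2).re]

/-- `G_univ = F` on `Re s > 1`: the zero sum of kernels is the Laplace transform of the diagonal.
[folklore] -/
theorem GK_univ_eq_mellinIoi {s : ℂ} (hs : 1 < s.re) : GK(Set.univ, s) = Landau.mellinIoi gL s := by
  rw [mellinIoi_gL, laplace_weilQuadratic_bump hs]
  exact tsum_congr fun ρ => by rw [Set.indicator_univ]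

/-- The cone `W₀ = {0 < Re s < 4, |Im s| < κ Re s}` is open. [folklore] -/
theorem isOpen_coneW (κ : ℝ) :
    IsOpen {s : ℂ | 0 < s.re ∧ s.re < 4 ∧ |s.im| < κ * s.re} := by
  refine (isOpen_lt continuous_const Complex.continuous_re).inter
    ((isOpen_lt Complex.continuous_re continuous_const).inter ?_)
  exact isOpen_lt (continuous_abs.comp Complex.continuous_im) (continuous_const.mul Complex.continuous_re)

/-- Linear functionals `s ↦ Im s − κ Re s` and `s ↦ −Im s − κ Re s` are `ℝ`-linear. [folklore] -/
theorem isLinearMap_im_sub (κ : ℝ) : IsLinearMap ℝ fun s : ℂ => s.im - κ * s.re :=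
  IsLinearMap.mk (fun x y => by simp; ring) (fun c x => by simp; ring)

/-- `s ↦ −Im s − κ Re s` is `ℝ`-linear. [folklore] -/
theorem isLinearMap_neg_im_sub (κ : ℝ) : IsLinearMap ℝ fun s : ℂ => -s.im - κ * s.re :=
  IsLinearMap.mk (fun x y => by simp; ring) (fun c x => by simp; ring)

/-- The cone `W₀` is convex (intersection of four half-planes). [folklore] -/
theorem convex_coneW (κ : ℝ) :
    Convex ℝ {s : ℂ | 0 < s.re ∧ s.re < 4 ∧ |s.im| < κ * s.re} := by
  have e : {s : ℂ | 0 < s.re ∧ s.re < 4 ∧ |s.im| < κ * s.re} =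
      {s : ℂ | 0 < s.re} ∩ ({s : ℂ | s.re < 4} ∩
        ({s : ℂ | s.im - κ * s.re < 0} ∩ {s : ℂ | -s.im - κ * s.re < 0})) := by
    ext s
    simp only [Set.mem_setOf_eq, Set.mem_inter_iff, abs_lt]
    constructor
    · rintro ⟨h1, h2, h3, h4⟩; exact ⟨h1, h2, by linarith, by linarith⟩
    · rintro ⟨h1, h2, h3, h4⟩; exact ⟨h1, h2, by linarith, by linarith⟩
  rw [e]
  exact (convex_halfSpace_re_gt 0).inter ((convex_halfSpace_re_lt 4).inter
    ((convex_halfSpace_lt (isLinearMap_im_sub κ) 0).inter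
      (convex_halfSpace_lt (isLinearMap_neg_im_sub κ) 0)))

/-- **Landau's lemma applied.** If `Re Q(φ_ε) ≥ 0` for `ε ≥ 1` and some cone
`{Re s > 0, |Im s| < κ Re s}` misses every segment, then the transform `F = ∫_1^∞ g x^{-(s+1)}`
converges absolutely for every real `σ > 0` and is holomorphic on `Re s > 0`. [folklore] -/
theorem differentiableOn_mellinIoi_gL
    (hpos : ∀ ε : ℝ, 1 ≤ ε → 0 ≤ (weilQuadratic φb(ε)).re) {κ : ℝ} (hκ : 0 < κ)
    (hW : ∀ s : ℂ, 0 < s.re → |s.im| < κ * s.re → s ∈ UP(Set.univ)) :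
    DifferentiableOn ℂ (Landau.mellinIoi gL) {s : ℂ | 0 < s.re} := by
  set W₀ : Set ℂ := {s : ℂ | 0 < s.re ∧ s.re < 4 ∧ |s.im| < κ * s.re} with hW₀
  have hW₀r : ∀ σ : ℝ, 0 < σ → σ ≤ 2 + 1 → (σ : ℂ) ∈ W₀ := fun σ h1 h2 =>
    ⟨by simpa using h1, by simp; linarith, by simp; positivity⟩
  have hΦ : DifferentiableOn ℂ (fun s : ℂ => GK(Set.univ, s)) ({s : ℂ | 2 < s.re} ∪ W₀) := by
    refine differentiableOn_GK Set.univ ?_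
    rintro s (hs | hs)
    · exact mem_UP_of_one_lt_re (by simp only [Set.mem_setOf_eq] at hs; linarith)
    · exact hW s hs.1 hs.2.2
  have hagree : EqOn (fun s : ℂ => GK(Set.univ, s)) (Landau.mellinIoi gL) {s : ℂ | 2 < s.re} :=
    fun s hs => GK_univ_eq_mellinIoi (by simp only [Set.mem_setOf_eq] at hs; linarith)
  have hposg : ∀ x : ℝ, Real.exp 1 < x → 0 ≤ gL x := fun x hx => by
    simp only [Set.indicator_of_mem (show x ∈ Ioi (Real.exp 1) from hx)]
    exact hpos _ (le_max_left _ _)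
  have hX₁ : (1 : ℝ) ≤ Real.exp 1 := (Real.one_lt_exp_iff.2 one_pos).le
  refine Landau.differentiableOn_mellinIoi_of_forall measurable_gL fun σ hσ => ?_
  exact Landau.integrableOn_of_differentiableOn_union_convex measurable_gL integrableOn_gL hX₁ hposg
    (by norm_num : (0 : ℝ) < 2) (isOpen_coneW κ) (convex_coneW κ) hW₀r hΦ hagree hσ

/-- **Identity theorem on a segment-free sector.** If `V ⊆ U_univ` is open, convex and contains a
point with `Re s > 2`, then `F = G_univ` on `V`. [folklore] -/
theorem eqOn_mellinIoi_GK (hF : DifferentiableOn ℂ (Landau.mellinIoi gL) {s : ℂ | 0 < s.re})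
    {V : Set ℂ} (hVo : IsOpen V) (hVc : Convex ℝ V) (hVU : V ⊆ UP(Set.univ))
    {p : ℂ} (hpV : p ∈ V) (hp : 2 < p.re) :
    EqOn (Landau.mellinIoi gL) (fun s : ℂ => GK(Set.univ, s)) V := by
  have hFV : AnalyticOnNhd ℂ (Landau.mellinIoi gL) V :=
    (hF.mono fun s hs => (hVU hs).1).analyticOnNhd hVo
  have hGV : AnalyticOnNhd ℂ (fun s : ℂ => GK(Set.univ, s)) V :=
    (differentiableOn_GK Set.univ hVU).analyticOnNhd hVo
  have hev : Landau.mellinIoi gL =ᶠ[𝓝 p] fun s : ℂ => GK(Set.univ, s) := by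
    filter_upwards [(Landau.isOpen_re_gt 2).mem_nhds (show p ∈ {s : ℂ | 2 < s.re} from hp)] with s hs
    have hs' : 2 < s.re := hs
    exact (GK_univ_eq_mellinIoi (by linarith)).symm
  exact hFV.eqOn_of_preconnected_of_eventuallyEq hGV hVc.isPreconnected hpV hev

/-- **Registered form `laplaceDiag_differentiableOn`** (crux stmt-RiemannHypothesis-11229, T2 component):
Landau's lemma applied to the diagonal. [folklore] -/
theorem laplaceDiag_differentiableOn :
    (∀ ε : ℝ, 1 ≤ ε → 0 ≤ (weilQuadratic (fun t : ℝ => ((ε : ℝ) : ℂ)⁻¹ * ((expNegInvGlue (1 - (t /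
    ε) ^ 2) : ℝ) : ℂ))).re) → ∀ κ : ℝ, 0 < κ → (∀ s : ℂ, 0 < s.re → |s.im| < κ * s.re → s ∈ (setOf
    fun s : ℂ => 0 < Complex.re s ∧ ∀ ρ' : ℂ, ρ' ∈ Set.univ → ρ' ∈
    ZetaZeros.riemannZetaNontrivialZeros → ∀ t : ℝ, t ∈ Set.Icc (-2 : ℝ) 2 → s ≠ (ρ' - 1 / 2) * t))
    → DifferentiableOn ℂ (Landau.mellinIoi (Set.indicator (Set.Ioi (Real.exp 1)) (fun x : ℝ =>
    Complex.re (weilQuadratic (fun t : ℝ => (((max 1 (Real.log x)) : ℝ) : ℂ)⁻¹ * ((expNegInvGlue (1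
    - (t / (max 1 (Real.log x))) ^ 2) : ℝ) : ℂ))))) ) {s : ℂ | 0 < s.re} :=
  fun hpos _ hκ hW => differentiableOn_mellinIoi_gL hpos hκ hW

/-! ## The one-zero kernel: symmetry and jump on a line -/

/-- `K(−w, s) = K(w, s)` (`ψ₀` is even; substitute `t ↦ −t`). [folklore] -/
theorem cauchyKernel_neg (w s : ℂ) : Kψ(-w, s) = Kψ(w, s) := by
  set f : ℝ → ℂ := fun u : ℝ => ((ψ₀(u) : ℝ) : ℂ) * Complex.exp (w * u - s) / (s - w * u) with hf
  have h : ∀ t : ℝ, ((ψ₀(t) : ℝ) : ℂ) * Complex.exp (-w * t - s) / (s - -w * t) = f (-t) := by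
    intro t
    simp only [hf]
    rw [bumpAutocorr_even, Complex.ofReal_neg, show w * -(t : ℂ) - s = -w * t - s by ring,
      show s - w * -(t : ℂ) = s - -w * t by ring]
  rw [intervalIntegral.integral_congr (g := fun t => f (-t)) (fun t _ => h t),
    intervalIntegral.integral_comp_neg, neg_neg]

/-- **Jump of one kernel on the line** `ℝ w₀`: for `w = c·w₀` (`c ≠ 0` real) and `0 < t₀ ≤ |c|`,
approaching `w₀ t₀ = w·(t₀/c)` along the common normal `n = i w₀/|w₀|`,
`K(w, w₀t₀ + ηn) − K(w, w₀t₀ − ηn) → −(2πi/(|c| w₀)) ψ₀(t₀/|c|)` (`cauchyKernel_jump`, and `K(−w) = K(w)`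
for `c < 0`). [folklore] -/
theorem kernel_jump_on_line {w₀ : ℂ} (hw₀ : w₀ ≠ 0) {c : ℝ} (hc : c ≠ 0) {t₀ : ℝ}
    (ht₀ : 0 < t₀) (ht₀c : t₀ ≤ |c|) :
    Tendsto (fun η : ℝ => Kψ((c : ℂ) * w₀, w₀ * t₀ + η * (I * w₀ / (‖w₀‖ : ℂ))) -
        Kψ((c : ℂ) * w₀, w₀ * t₀ - η * (I * w₀ / (‖w₀‖ : ℂ))))
      (𝓝[>] 0) (𝓝 (-(2 * π * I / (((|c| : ℝ) : ℂ) * w₀)) * (((ψ₀(t₀ / |c|)) : ℝ) : ℂ))) := by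
  have hcont : Continuous fun t : ℝ => ((ψ₀(t) : ℝ) : ℂ) :=
    Complex.continuous_ofReal.comp continuous_bumpAutocorr
  have hca : 0 < |c| := abs_pos.2 hc
  have hca0 : ((|c| : ℝ) : ℂ) ≠ 0 := Complex.ofReal_ne_zero.2 hca.ne'
  have hn0 : (‖w₀‖ : ℂ) ≠ 0 := Complex.ofReal_ne_zero.2 (norm_ne_zero_iff.2 hw₀)
  set w' : ℂ := ((|c| : ℝ) : ℂ) * w₀ with hw'def
  have hw' : w' ≠ 0 := mul_ne_zero hca0 hw₀
  have ht : t₀ / |c| ∈ Set.Ioo (-2 : ℝ) 2 := by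
    constructor
    · have : 0 < t₀ / |c| := div_pos ht₀ hca
      linarith
    · have : t₀ / |c| ≤ 1 := (div_le_one hca).2 ht₀c
      linarith
  have hj := cauchyKernel_jump _ hcont w' hw' (t₀ / |c|) ht
  have e1 : w' * ((t₀ / |c| : ℝ) : ℂ) = w₀ * (t₀ : ℂ) := by
    rw [hw'def]; push_cast; field_simp
  have e2 : I * w' / (‖w'‖ : ℂ) = I * w₀ / (‖w₀‖ : ℂ) := by
    have hn : ‖w'‖ = |c| * ‖w₀‖ := by
      rw [hw'def, norm_mul, Complex.norm_real, Real.norm_eq_abs, abs_abs]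
    rw [hn, hw'def]; push_cast; field_simp
  rw [e1, e2] at hj
  have hK : ∀ s : ℂ, Kψ((c : ℂ) * w₀, s) = Kψ(w', s) := by
    intro s
    rcases lt_or_gt_of_ne hc with hneg | hpos
    · have : (c : ℂ) * w₀ = -w' := by
        rw [hw'def, abs_of_neg hneg]; push_cast; ring
      rw [this, cauchyKernel_neg]
    · rw [hw'def, abs_of_pos hpos]
  refine Tendsto.congr (fun η => ?_) hj
  rw [hK, hK]

/-- Real and imaginary parts of the approach points `w₀ t₀ ± η · i w₀/|w₀|`. [folklore] -/
theorem approach_re_im (w₀ : ℂ) (t₀ η : ℝ) :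
    (w₀ * t₀ + η * (I * w₀ / (‖w₀‖ : ℂ))).re = w₀.re * t₀ - η * (w₀.im / ‖w₀‖) ∧
    (w₀ * t₀ + η * (I * w₀ / (‖w₀‖ : ℂ))).im = w₀.im * t₀ + η * (w₀.re / ‖w₀‖) ∧
    (w₀ * t₀ - η * (I * w₀ / (‖w₀‖ : ℂ))).re = w₀.re * t₀ + η * (w₀.im / ‖w₀‖) ∧
    (w₀ * t₀ - η * (I * w₀ / (‖w₀‖ : ℂ))).im = w₀.im * t₀ - η * (w₀.re / ‖w₀‖) := by
  have h1 : (I * w₀ / (‖w₀‖ : ℂ)).re = -(w₀.im / ‖w₀‖) := by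
    rw [Complex.div_ofReal_re]; simp [Complex.mul_re]; ring
  have h2 : (I * w₀ / (‖w₀‖ : ℂ)).im = w₀.re / ‖w₀‖ := by
    rw [Complex.div_ofReal_im]; simp [Complex.mul_im]
  refine ⟨?_, ?_, ?_, ?_⟩ <;>
    simp only [Complex.add_re, Complex.add_im, Complex.sub_re, Complex.sub_im,
      h1, h2, Complex.mul_re, Complex.mul_im,
      Complex.ofReal_re, Complex.ofReal_im, mul_zero, sub_zero, zero_add] <;> ring

end Summit.RiemannHypothesis.RiemannHypothesis.Theorems.WeilCombBohrFejer

end
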